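import Mathlib
import HarnessLib
import Summits.HubbardSuperconductivity.HubbardSuperconductivity.Theorems.KLProgrammeKLRegimeTwoVolumeFrameMismatchResponseDoor
import Summits.HubbardSuperconductivity.HubbardSuperconductivity.Theorems.KLProgrammeKLRegimeEngineCovarianceResponseFourLeg
import Summits.HubbardSuperconductivity.HubbardSuperconductivity.Theorems.KLProgrammeKLRegimeSplitFrameDist

/-!
# K3 ENGINE child (stmt-HubbardSuperconductivity-20437 `KLRegimeEngineV17F2`), stub (c) `hshift` producer «(c)-HSHIFT-4LEG»:
# the four-leg covariance-response door RE-TYPED FOR THE VERTEX `V_U + 𝒩_K` and composed with the FRAME-MISMATCH defect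

Cell gate-hubbard-kl, seat p2 (g23).  The scale-`n` one-shot action `T_n(K) = klEffectiveAction … K klE0 n` is
`effAction (normalCovariance Ψ_K) (V_U + 𝒩_K)` (counterterm kept as a vertex), and two frames `K₁, K₂` are compared through k3c4-p2's
mismatch resummation (`…TwoVolumeFrameMismatchResum`: `T_n(K₂) = chain_D + S_m·𝒲′[Ψ̃]`, `T_n(K₁) = 𝒲′[Ψ_{K₁}]`,
`𝒲′[s] := effAction (normalCovariance s) (V_U + 𝒩_{K₁})`, `Ψ̃ = Ψ_{K₂}/(1 + Ψ_{K₂}κ_D)`, `D = K₂ ⊖ K₁`).  So the `hshift` producer needs the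
four-leg door of `…EngineCovarianceResponseFourLeg` (p668577, vertex `V_U`) for the vertex `V_U + 𝒩_K`.  Everything that door uses of the vertex —
even, no constant part, the selection rules — holds for `V_U + 𝒩_K` (k3c4-p2 g8, `…TwoVolumeFrameMismatchResponseDoor` §1–§2:
`covRespCT_kernel_two_eq_zero_of_charge_eq`, `covRespCT_kernel_two_pair_eq_zero_of_ne`); the loop lemma and the antisymmetry lemma are vertex-free.

* §1 `covRespCT_kernel_two_eq_zero_of_ne_bar` — `𝒲′₂(A, X) = 0` unless `A = X̄`;
* §2 `covRespCT_norm_kernel_four_pairing_le` — the tree term is a product: `≤ 4·(Σ_i ‖ṡ(X_i.1)‖·‖𝒲′₂(X̄_i,X_i)‖)·‖𝒲′₄(X)‖`;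
* §3 **`covRespCT_norm_kernel_four_sub_le`** — `‖𝒲′[s₁]₄(X) − 𝒲′[s₀]₄(X)‖ ≤ 30·(Σ_p‖(s₁−s₀) p‖)·N₆ + 8·D·S·N₄` (hypotheses as in the `V_U` door);
* §4 **`covRespCT_norm_kernel_four_mismatch_sub_le`** — composed with the mismatch defect `d = Ψ̃ − Ψ_{K₁}` of `…TwoVolumeFrameMismatchResum`
  (`norm_mismatchDefect_le`: `‖d(ks)‖ ≤ βL²(200+200B₁)/Λ²·|D(p_k⃗)|`, `sum_norm_mismatchDefect_le`: `Σ‖d‖ ≤ #{|ω|<Λ}·βL²(200+200B₁)/Λ²·t`) under the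
  sole smallness `frameDist K₂ K₁ ≤ Λ/4`:
  `‖𝒲′[Ψ̃]₄(X) − 𝒲′[Ψ_{K₁}]₄(X)‖ ≤ (30·#{|ω|<Λ}·N₆ + 8·S·N₄)·(βL²(200+200B₁)/Λ²)·frameDist K₂ K₁` — linear in `frameDist`, the defect SINGLE-SCALE.

Proofs only; no definitions; `N₆`, `S`, `N₄`, `Z_t` are hypotheses; nothing about the model\'s sizes is asserted; nothing here asserts (c), (C), K3 or
superconductivity.  References: Salmhofer 1998 §3.1 Prop. 1 [cite: Salmhofer1998]; BGM 2006 §2.3 (2.21)–(2.24) [cite: BenfattoGiulianiMastropietro2006];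
FST 1996 §1 [cite: FeldmanSalmhoferTrubowitz1996].
-/

noncomputable section

namespace Summit.HubbardSuperconductivity.HubbardSuperconductivity.Theorems.EngineV8

set_option linter.dupNamespace false -- summit = problem name (single-conjunct summit), D-0017

open Finset Literature.MathematicalPhysics.QuantumLattice Literature.Probability.LatticeModels GrassmannAlgebra
open Summit.HubbardSuperconductivity.HubbardSuperconductivity.Theorems.TwoPointAssembly
open Summit.HubbardSuperconductivity.HubbardSuperconductivity.Theorems.TwoVolumeDefect
open Summit.HubbardSuperconductivity.HubbardSuperconductivity.Theorems.KLRegimeSplit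

variable {L M : ℕ} [NeZero L]

/-! ## §1 Selection rule in pairing form for `𝒲′[s]` -/

/-- **Selection rule, pairing form**: the two-leg kernel of `𝒲′[s] = effAction (normalCovariance s) (V_U + 𝒩_K)` at `(A, X)` vanishes unless `A = X̄ := (X.1, 1 − X.2)`
(same `(frequency, momentum, spin)`, opposite charge). -/
theorem covRespCT_kernel_two_eq_zero_of_ne_bar (s : FreqMomentum L M × Fin 2 → ℂ) (β U : ℝ) (K : TrigPolyC4v) {A X : HubbardFieldIdx L M}
    (h : A ≠ (X.1, 1 - X.2)) :
    kernel ℂ (effAction ℂ (normalCovariance L M s) (hubbardInteraction L M β U + counterQuadratic L M β K)) 2 ![A, X] = 0 := by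
  obtain ⟨p, c⟩ := A
  obtain ⟨q, d⟩ := X
  by_cases hcd : c = d
  · subst hcd
    exact covRespCT_kernel_two_eq_zero_of_charge_eq β U K s p q c
  · have hpq : p ≠ q := by
      rintro rfl
      refine h (Prod.ext rfl ?_)
      show c = 1 - d
      fin_cases c <;> fin_cases d <;> simp_all
    fin_cases c <;> fin_cases d
    · exact absurd rfl hcd
    · exact (covRespCT_kernel_two_pair_eq_zero_of_ne β U K s hpq).2
    · exact (covRespCT_kernel_two_pair_eq_zero_of_ne β U K s hpq).1
    · exact absurd rfl hcd

/-! ## §2 The tree term is a product (vertex `V_U + 𝒩_K`) -/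

/-- **The tree (pairing) term of the four-leg response at `X` in norm is a PRODUCT**, vertex `V_U + 𝒩_K`:
`‖kernel (δ𝒲/δψ, Ċ δ𝒲/δψ) 4 X‖ ≤ 4·(Σ_i ‖ṡ(X_i.1)‖·‖𝒲₂(X̄_i, X_i)‖)·‖𝒲₄(X)‖` for `Ċ = normalCovariance ṡ`, `𝒲 = 𝒲′[s]` (vertex `V_U + 𝒩_K`):
in `Σ_A Ċ(A,Ā)·[(∂_A 𝒲)(∂_Ā 𝒲)]₄(X)` (degree-`4` product formula) the selection rule leaves only `A ∈ {X̄_i, X_i}`, and the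
surviving four-leg kernels sit at the strings `(X_i, X̂_i)`, of norm `‖𝒲₄(X)‖` by antisymmetry.  No mass of `Ċ`. -/
theorem covRespCT_norm_kernel_four_pairing_le (sdot s : FreqMomentum L M × Fin 2 → ℂ) (β U : ℝ) (K : TrigPolyC4v)
    (X : Fin 4 → HubbardFieldIdx L M) :
    ‖kernel ℂ (grassmannDerivPairing ℂ (normalCovariance L M sdot)
        (effAction ℂ (normalCovariance L M s) (hubbardInteraction L M β U + counterQuadratic L M β K))
        (effAction ℂ (normalCovariance L M s) (hubbardInteraction L M β U + counterQuadratic L M β K))) 4 X‖ ≤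
      4 * (∑ i : Fin 4, ‖sdot (X i).1‖ *
          ‖kernel ℂ (effAction ℂ (normalCovariance L M s) (hubbardInteraction L M β U + counterQuadratic L M β K)) 2
            ![(((X i).1, 1 - (X i).2) : HubbardFieldIdx L M), X i]‖) *
        ‖kernel ℂ (effAction ℂ (normalCovariance L M s) (hubbardInteraction L M β U + counterQuadratic L M β K)) 4 X‖ := by
  classical
  set W := effAction ℂ (normalCovariance L M s) (hubbardInteraction L M β U + counterQuadratic L M β K) with hW
  have hWe : W ∈ evenOdd ℂ (ι := HubbardFieldIdx L M) 0 :=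
    mem_evenPart_iff.1 (effAction_mem_evenPart _ (hubbardInteraction_add_counterQuadratic_mem_evenPart β U K)
      (constPart_hubbardInteraction_add_counterQuadratic β U K))
  have hbb : ∀ A : HubbardFieldIdx L M,
      ((((A.1, 1 - A.2) : HubbardFieldIdx L M).1, 1 - ((A.1, 1 - A.2) : HubbardFieldIdx L M).2) : HubbardFieldIdx L M) = A :=
    fun A => Prod.ext rfl (sub_sub_cancel 1 A.2)
  have hsel : ∀ A Q : HubbardFieldIdx L M, A ≠ (Q.1, 1 - Q.2) → kernel ℂ W 2 ![A, Q] = 0 := fun A Q h => by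
    rw [hW]; exact covRespCT_kernel_two_eq_zero_of_ne_bar s β U K h
  have hsel' : ∀ A Q : HubbardFieldIdx L M, A ≠ Q → kernel ℂ W 2 ![((A.1, 1 - A.2) : HubbardFieldIdx L M), Q] = 0 :=
    fun A Q h => hsel _ Q fun h' => h (by
      have h1 := congrArg Prod.fst h'
      have h2 := congrArg Prod.snd h'
      dsimp only at h1 h2
      exact Prod.ext h1 (sub_right_injective h2))
  have hCn : ∀ A : HubbardFieldIdx L M, ‖normalCovariance L M sdot A (A.1, 1 - A.2)‖ = ‖sdot A.1‖ :=
    norm_normalCovariance_bar_right sdot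
  have hCn' : ∀ A : HubbardFieldIdx L M, ‖normalCovariance L M sdot (A.1, 1 - A.2) A‖ = ‖sdot A.1‖ :=
    norm_normalCovariance_bar_left sdot
  -- (1) expand the pairing; the inner sum only sees `B = Ā`
  have hexp : kernel ℂ (grassmannDerivPairing ℂ (normalCovariance L M sdot) W W) 4 X =
      ∑ A : HubbardFieldIdx L M, normalCovariance L M sdot A (A.1, 1 - A.2) *
        kernel ℂ (grassmannDeriv ℂ A W * grassmannDeriv ℂ ((A.1, 1 - A.2) : HubbardFieldIdx L M) W) 4 X := by
    rw [grassmannDerivPairing_apply, kernel_sum]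
    refine sum_congr rfl fun A _ => ?_
    rw [kernel_sum]
    simp only [kernel_smul]
    exact Finset.sum_eq_single ((A.1, 1 - A.2) : HubbardFieldIdx L M)
      (fun B _ hB => by rw [normalCovariance_eq_zero_of_ne_bar sdot A B hB, zero_mul]) (fun h => absurd (mem_univ _) h)
  -- (2) the collapse of the product sums under the selection rule
  have G1 : ∀ (Q : HubbardFieldIdx L M) (Z : Fin 3 → HubbardFieldIdx L M),
      ∑ A : HubbardFieldIdx L M, ‖normalCovariance L M sdot A (A.1, 1 - A.2)‖ *
          (‖kernel ℂ W 2 ![A, Q]‖ * ‖kernel ℂ W 4 (Matrix.vecCons ((A.1, 1 - A.2) : HubbardFieldIdx L M) Z)‖) =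
        ‖sdot Q.1‖ * (‖kernel ℂ W 2 ![((Q.1, 1 - Q.2) : HubbardFieldIdx L M), Q]‖ * ‖kernel ℂ W 4 (Matrix.vecCons Q Z)‖) := by
    intro Q Z
    rw [Finset.sum_eq_single ((Q.1, 1 - Q.2) : HubbardFieldIdx L M)
      (fun A _ hA => by rw [hsel A Q hA, norm_zero, zero_mul, mul_zero]) (fun h => absurd (mem_univ _) h), hbb Q, hCn' Q]
  have G2 : ∀ (Q : HubbardFieldIdx L M) (Z : Fin 3 → HubbardFieldIdx L M),
      ∑ A : HubbardFieldIdx L M, ‖normalCovariance L M sdot A (A.1, 1 - A.2)‖ *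
          (‖kernel ℂ W 4 (Matrix.vecCons A Z)‖ * ‖kernel ℂ W 2 ![((A.1, 1 - A.2) : HubbardFieldIdx L M), Q]‖) =
        ‖sdot Q.1‖ * (‖kernel ℂ W 4 (Matrix.vecCons Q Z)‖ * ‖kernel ℂ W 2 ![((Q.1, 1 - Q.2) : HubbardFieldIdx L M), Q]‖) := by
    intro Q Z
    rw [Finset.sum_eq_single Q (fun A _ hA => by rw [hsel' A Q hA, norm_zero, mul_zero, mul_zero])
      (fun h => absurd (mem_univ _) h), hCn Q]
  obtain ⟨m0, m1, m2, m3⟩ := norm_kernel_four_minors_eq W X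
  -- (3) assemble
  rw [hexp]
  refine (norm_sum_le _ _).trans ?_
  refine (sum_le_sum fun A _ => (norm_mul_le _ _).trans
    (mul_le_mul_of_nonneg_left (norm_kernel_four_deriv_mul_deriv_le hWe hWe A ((A.1, 1 - A.2) : HubbardFieldIdx L M) X)
      (norm_nonneg _))).trans ?_
  refine le_of_eq ?_
  simp only [mul_left_comm _ (2 : ℝ)]
  rw [← Finset.mul_sum]
  simp only [mul_add, Finset.sum_add_distrib]
  rw [G1 (X 0) ![X 1, X 2, X 3], G1 (X 1) ![X 0, X 2, X 3], G1 (X 2) ![X 0, X 1, X 3], G1 (X 3) ![X 0, X 1, X 2],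
    G2 (X 3) ![X 0, X 1, X 2], G2 (X 2) ![X 0, X 1, X 3], G2 (X 1) ![X 0, X 2, X 3], G2 (X 0) ![X 1, X 2, X 3]]
  rw [m0, m1, m2, m3, Fin.sum_univ_four]
  ring

/-! ## §3 The response inequality for `𝒲′` at one four-leg string -/

/-- **THE COVARIANCE RESPONSE OF THE FOUR-LEG KERNEL OF `𝒲′` AT ONE STRING** (vertex `V_U + 𝒩_K`; Polchinski interpolation, mean-value form).
`𝒲′_t := effAction (C₀ + t(C₁ − C₀)) (V_U + 𝒩_K)`, `C_i = normalCovariance s_i`; if on `t ∈ [0,1]` the partition function does not vanish,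
the six-leg kernels at `(X, Ā, A)` are `≤ N₆`, the two-leg kernels at `(X̄_i, X_i)` are `≤ S`, the four-leg kernel at `X` is `≤ N₄`,
and the symbol shift at the external labels is `≤ D` (`‖(s₁ − s₀)(X_i.1)‖ ≤ D`), then
`‖𝒲′[s₁]₄(X) − 𝒲′[s₀]₄(X)‖ ≤ 30·(Σ_p ‖(s₁−s₀) p‖)·N₆ + 8·D·S·N₄`. -/
theorem covRespCT_norm_kernel_four_sub_le (s₀ s₁ : FreqMomentum L M × Fin 2 → ℂ) (β U : ℝ) (K : TrigPolyC4v)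
    (X : Fin 4 → HubbardFieldIdx L M)
    (hZ : ∀ t ∈ Set.Icc (0 : ℝ) 1, effPartitionFn ℂ (normalCovariance L M s₀ + ((t : ℂ)) • (normalCovariance L M s₁ - normalCovariance L M s₀))
      (hubbardInteraction L M β U + counterQuadratic L M β K) ≠ 0)
    {N₆ S N₄ D : ℝ}
    (hN6 : ∀ t ∈ Set.Icc (0 : ℝ) 1, ∀ A : HubbardFieldIdx L M,
      ‖kernel ℂ (effAction ℂ (normalCovariance L M s₀ + ((t : ℂ)) • (normalCovariance L M s₁ - normalCovariance L M s₀))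
        (hubbardInteraction L M β U + counterQuadratic L M β K)) 6 (Fin.snoc (Fin.snoc X (A.1, 1 - A.2) : Fin 5 → HubbardFieldIdx L M) A)‖ ≤ N₆)
    (hS : ∀ t ∈ Set.Icc (0 : ℝ) 1, ∀ i : Fin 4,
      ‖kernel ℂ (effAction ℂ (normalCovariance L M s₀ + ((t : ℂ)) • (normalCovariance L M s₁ - normalCovariance L M s₀))
        (hubbardInteraction L M β U + counterQuadratic L M β K)) 2 ![(((X i).1, 1 - (X i).2) : HubbardFieldIdx L M), X i]‖ ≤ S)
    (hN4 : ∀ t ∈ Set.Icc (0 : ℝ) 1,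
      ‖kernel ℂ (effAction ℂ (normalCovariance L M s₀ + ((t : ℂ)) • (normalCovariance L M s₁ - normalCovariance L M s₀))
        (hubbardInteraction L M β U + counterQuadratic L M β K)) 4 X‖ ≤ N₄)
    (hD : ∀ i : Fin 4, ‖s₁ (X i).1 - s₀ (X i).1‖ ≤ D) :
    ‖kernel ℂ (effAction ℂ (normalCovariance L M s₁) (hubbardInteraction L M β U + counterQuadratic L M β K)) 4 X -
        kernel ℂ (effAction ℂ (normalCovariance L M s₀) (hubbardInteraction L M β U + counterQuadratic L M β K)) 4 X‖ ≤
      30 * (∑ p, ‖s₁ p - s₀ p‖) * N₆ + 8 * D * S * N₄ := by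
  classical
  letI : LinearOrder (HubbardFieldIdx L M) := LinearOrder.lift' (Fintype.equivFin _) (Fintype.equivFin _).injective
  -- the four-leg kernel at `X` as a linear functional
  let Φ : HubbardGrassmann L M →ₗ[ℂ] ℂ :=
    { toFun := fun F => kernel ℂ F 4 X
      map_add' := fun F G => kernel_add ℂ F G 4 X
      map_smul' := fun c F => by rw [kernel_smul, RingHom.id_apply, smul_eq_mul] }
  have hΦ1 : Φ 1 = 0 := by
    show kernel ℂ (1 : HubbardGrassmann L M) 4 X = 0
    rw [kernel_def, iterDeriv_succ_apply, grassmannDeriv_one, map_zero, map_zero, mul_zero]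
  have hV0 := constPart_hubbardInteraction_add_counterQuadratic (L := L) (M := M) β U K
  have hVe : hubbardInteraction L M β U + counterQuadratic L M β K ∈ evenOdd ℂ (ι := HubbardFieldIdx L M) 0 :=
    hubbardInteraction_add_counterQuadratic_mem_evenOdd_zero β U K
  refine norm_apply_effAction_sub_le_of_linePath (normalCovariance L M s₀) (normalCovariance L M s₁) hV0 hVe hZ Φ hΦ1 ?_
  intro t ht
  have hNt := hN6 t ht
  have hSt := hS t ht
  have hN4t := hN4 t ht
  rw [normalCovariance_linePath, normalCovariance_sub]
  rw [normalCovariance_linePath] at hNt hSt hN4t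
  set st : FreqMomentum L M × Fin 2 → ℂ := fun p => s₀ p + (t : ℂ) * (s₁ p - s₀ p) with hst
  set W := effAction ℂ (normalCovariance L M st) (hubbardInteraction L M β U + counterQuadratic L M β K) with hW
  have hloop : ‖Φ (grassmannLaplacian ℂ (normalCovariance L M fun p => s₁ p - s₀ p) W)‖ ≤ 30 * (∑ p, ‖s₁ p - s₀ p‖) * N₆ :=
    covResp_norm_kernel_four_laplacian_le (fun p => s₁ p - s₀ p) W X hNt
  have htree : ‖Φ (grassmannDerivPairing ℂ (normalCovariance L M fun p => s₁ p - s₀ p) W W)‖ ≤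
      4 * (∑ i : Fin 4, ‖s₁ (X i).1 - s₀ (X i).1‖ *
          ‖kernel ℂ W 2 ![(((X i).1, 1 - (X i).2) : HubbardFieldIdx L M), X i]‖) * ‖kernel ℂ W 4 X‖ :=
    covRespCT_norm_kernel_four_pairing_le (fun p => s₁ p - s₀ p) st β U K X
  have hS0 : 0 ≤ S := (norm_nonneg _).trans (hSt 0)
  have hsum : ∑ i : Fin 4, ‖s₁ (X i).1 - s₀ (X i).1‖ *
      ‖kernel ℂ W 2 ![(((X i).1, 1 - (X i).2) : HubbardFieldIdx L M), X i]‖ ≤ 4 * (D * S) := by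
    calc _ ≤ ∑ _i : Fin 4, D * S :=
          sum_le_sum fun i _ => mul_le_mul (hD i) (hSt i) (norm_nonneg _) ((norm_nonneg _).trans (hD i))
      _ = 4 * (D * S) := by simp
  have hD0 : 0 ≤ D := (norm_nonneg _).trans (hD 0)
  have htree' : ‖Φ (grassmannDerivPairing ℂ (normalCovariance L M fun p => s₁ p - s₀ p) W W)‖ ≤ 4 * (4 * (D * S)) * N₄ :=
    htree.trans (mul_le_mul (mul_le_mul_of_nonneg_left hsum (by norm_num)) hN4t (norm_nonneg _)
      (mul_nonneg (by norm_num) (mul_nonneg (by norm_num) (mul_nonneg hD0 hS0))))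
  calc ‖Φ (grassmannLaplacian ℂ (normalCovariance L M fun p => s₁ p - s₀ p) W) -
        (2 : ℂ)⁻¹ * Φ (grassmannDerivPairing ℂ (normalCovariance L M fun p => s₁ p - s₀ p) W W)‖
      ≤ ‖Φ (grassmannLaplacian ℂ (normalCovariance L M fun p => s₁ p - s₀ p) W)‖ +
          ‖(2 : ℂ)⁻¹ * Φ (grassmannDerivPairing ℂ (normalCovariance L M fun p => s₁ p - s₀ p) W W)‖ := norm_sub_le _ _
    _ ≤ 30 * (∑ p, ‖s₁ p - s₀ p‖) * N₆ + 8 * D * S * N₄ := by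
      refine add_le_add hloop ?_
      rw [norm_mul, norm_inv, RCLike.norm_ofNat]
      calc (2 : ℝ)⁻¹ * ‖Φ (grassmannDerivPairing ℂ (normalCovariance L M fun p => s₁ p - s₀ p) W W)‖
          ≤ 2⁻¹ * (4 * (4 * (D * S)) * N₄) := mul_le_mul_of_nonneg_left htree' (by norm_num)
        _ = 8 * D * S * N₄ := by ring

/-! ## §4 Composition with the frame-MISMATCH defect (k3c4-p2's `…TwoVolumeFrameMismatchResum`) -/

/-- **THE FOUR-LEG MISMATCH RESPONSE AT ONE STRING**: with `s₀ = Ψ_{K₁} = uvSymbolCT … K₁ Λ`, `s₁ = Ψ̃ = Ψ_{K₂}/(1 + Ψ_{K₂}·κ_D)` (`D = K₂ ⊖ K₁`,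
`κ_D = D(p_k⃗)/(βL²)`), the vertex `V_U + 𝒩_{K₁}`, the sole smallness `frameDist K₂ K₁ ≤ Λ/4`, and the hypotheses of `covRespCT_norm_kernel_four_sub_le`
along the interpolation (`Z_t ≠ 0`; six-leg kernels at `(X, Ā, A)` `≤ N₆`; two-leg kernels at `(X̄_i, X_i)` `≤ S`; the four-leg kernel at `X` `≤ N₄`):
`‖𝒲′[Ψ̃]₄(X) − 𝒲′[Ψ_{K₁}]₄(X)‖ ≤ 30·(#{ks : |ω| < Λ}·βL²(200+200B₁)/Λ²·frameDist K₂ K₁)·N₆ + 8·(βL²(200+200B₁)/Λ²·frameDist K₂ K₁)·S·N₄`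
(`norm_mismatchDefect_le` pointwise at the four external labels, `sum_norm_mismatchDefect_le` for the entry sum; `|D(p)| ≤ frameDist K₂ K₁` by
`eval_fsub` + `abs_eval_sub_le_frameDist`). -/
theorem covRespCT_norm_kernel_four_mismatch_sub_le {β : ℝ} (hβ : 0 < β) {B₁ : ℝ} (hB0 : 0 ≤ B₁) (hB : ∀ y, |deriv salmhoferCutoff y| ≤ B₁)
    {Λ : ℝ} (hΛ : 0 < Λ) (μ U : ℝ) (K₁ K₂ : TrigPolyC4v) (hfd : frameDist K₂ K₁ ≤ Λ / 4) {s₀ s₁ : FreqMomentum L M × Fin 2 → ℂ}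
    (hs₀ : s₀ = uvSymbolCT L M β μ K₁ Λ)
    (hs₁ : s₁ = fun ks => uvSymbolCT L M β μ K₂ Λ ks /
      (1 + uvSymbolCT L M β μ K₂ Λ ks * (((fsub K₂ K₁).eval (latticeMomentum L ks.1.2) / (β * (L : ℝ) ^ 2) : ℝ) : ℂ)))
    (X : Fin 4 → HubbardFieldIdx L M)
    (hZ : ∀ t ∈ Set.Icc (0 : ℝ) 1, effPartitionFn ℂ (normalCovariance L M s₀ + ((t : ℂ)) • (normalCovariance L M s₁ - normalCovariance L M s₀))
      (hubbardInteraction L M β U + counterQuadratic L M β K₁) ≠ 0)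
    {N₆ S N₄ : ℝ}
    (hN6 : ∀ t ∈ Set.Icc (0 : ℝ) 1, ∀ A : HubbardFieldIdx L M,
      ‖kernel ℂ (effAction ℂ (normalCovariance L M s₀ + ((t : ℂ)) • (normalCovariance L M s₁ - normalCovariance L M s₀))
        (hubbardInteraction L M β U + counterQuadratic L M β K₁)) 6 (Fin.snoc (Fin.snoc X (A.1, 1 - A.2) : Fin 5 → HubbardFieldIdx L M) A)‖ ≤ N₆)
    (hS : ∀ t ∈ Set.Icc (0 : ℝ) 1, ∀ i : Fin 4,
      ‖kernel ℂ (effAction ℂ (normalCovariance L M s₀ + ((t : ℂ)) • (normalCovariance L M s₁ - normalCovariance L M s₀))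
        (hubbardInteraction L M β U + counterQuadratic L M β K₁)) 2 ![(((X i).1, 1 - (X i).2) : HubbardFieldIdx L M), X i]‖ ≤ S)
    (hN4 : ∀ t ∈ Set.Icc (0 : ℝ) 1,
      ‖kernel ℂ (effAction ℂ (normalCovariance L M s₀ + ((t : ℂ)) • (normalCovariance L M s₁ - normalCovariance L M s₀))
        (hubbardInteraction L M β U + counterQuadratic L M β K₁)) 4 X‖ ≤ N₄) :
    ‖kernel ℂ (effAction ℂ (normalCovariance L M s₁) (hubbardInteraction L M β U + counterQuadratic L M β K₁)) 4 X -
        kernel ℂ (effAction ℂ (normalCovariance L M s₀) (hubbardInteraction L M β U + counterQuadratic L M β K₁)) 4 X‖ ≤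
      30 * ((((Finset.univ.filter fun ks : FreqMomentum L M × Fin 2 => |matsubaraFreq β M ks.1.1| < Λ).card : ℕ) : ℝ) *
          (β * (L : ℝ) ^ 2 * (200 + 200 * B₁) / Λ ^ 2 * frameDist K₂ K₁)) * N₆ +
        8 * (β * (L : ℝ) ^ 2 * (200 + 200 * B₁) / Λ ^ 2 * frameDist K₂ K₁) * S * N₄ := by
  have hL : (0 : ℝ) < L := by exact_mod_cast NeZero.pos L
  have hD : ∀ kv : TorusSite 2 L, |(fsub K₂ K₁).eval (latticeMomentum L kv)| ≤ frameDist K₂ K₁ := fun kv => by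
    rw [eval_fsub]; exact abs_eval_sub_le_frameDist K₂ K₁ _
  have hDi : ∀ i : Fin 4, ‖s₁ (X i).1 - s₀ (X i).1‖ ≤ β * (L : ℝ) ^ 2 * (200 + 200 * B₁) / Λ ^ 2 * frameDist K₂ K₁ := by
    intro i
    subst hs₀ hs₁
    have h := norm_mismatchDefect_le hβ μ K₁ K₂ Λ hB0 hB hΛ (X i).1.1.1 (X i).1.1.2 (X i).1.2 ((hD _).trans hfd)
    exact h.trans (mul_le_mul_of_nonneg_left (hD _) (by positivity))
  have h1 : ∑ p, ‖s₁ p - s₀ p‖ ≤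
      (((Finset.univ.filter fun ks : FreqMomentum L M × Fin 2 => |matsubaraFreq β M ks.1.1| < Λ).card : ℕ) : ℝ) *
        (β * (L : ℝ) ^ 2 * (200 + 200 * B₁) / Λ ^ 2 * frameDist K₂ K₁) := by
    subst hs₀ hs₁
    exact sum_norm_mismatchDefect_le hβ μ K₁ K₂ Λ hB0 hB hΛ hfd hD
  have h := covRespCT_norm_kernel_four_sub_le s₀ s₁ β U K₁ X hZ hN6 hS hN4 hDi
  refine h.trans (add_le_add ?_ le_rfl)
  have hN60 : 0 ≤ N₆ := (norm_nonneg _).trans (hN6 0 ⟨le_rfl, zero_le_one⟩ (X 0))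
  exact mul_le_mul_of_nonneg_right (mul_le_mul_of_nonneg_left h1 (by norm_num)) hN60

end Summit.HubbardSuperconductivity.HubbardSuperconductivity.Theorems.EngineV8

end
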